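import Literature.IUT.LogThetaLattice.RealifiedSemisimplification
import Mathlib.MeasureTheory.Measure.Lebesgue.Basic
import Mathlib.MeasureTheory.Measure.Haar.Basic
import Mathlib.MeasureTheory.Measure.OpenPos
import HarnessLib

/-!
# [IUTchIII] Remark 3.9.4 (i): AMPLE subsets and AMPLE measure spaces EXIST for the measures the remark is about
# (compact sets of positive measure; open-positive measures on locally compact spaces; Haar measures; Lebesgue)

PROOF-ONLY companion (abc-iut cell, wave-5 prover seat abc-iut-w5-d114 gen 3; §4 (iii) non-vacuity register, L6 column)
of abc-iut-L4-t3's `RealifiedSemisimplification.lean`. S. Mochizuki, *Inter-universal Teichmüller theory III*, kurims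
manuscript (May 2020), §3, Remark 3.9.4 (i) p. 120 l. 23–25 [claim: Mochizuki2012, status: disputed]: "a subset
`S ⊆ M` is pre-ample if `S` is a relatively compact Borel set … ample if `μ_M(S) > 0` … `(M, μ_M)` is ample if there
exists an ample subset". The typed hypothesis packages `Rss.IsAmple μ S` / `Rss.IsAmpleSpace μ` (consumed by the PROVED
surjectivity `Rss_integral_surjective_holds`) had NO kernel instance in the tree (this seat's L6 inhabitation census v6b,
2026-08-26 08:58Z). Classical content only:

* `Rss.isPreAmple_of_isCompact`, `Rss.isAmple_of_isCompact` — a compact Borel set (of positive measure) is (pre-)ample;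
* `Rss.isAmpleSpace_of_isOpenPosMeasure` — every measure positive on nonempty open sets on a nonempty locally compact
  Hausdorff space is ample (a compact neighbourhood of a point has positive measure); hence
  `Rss.isAmpleSpace_of_isHaarMeasure` / `…_of_isAddHaarMeasure` — every (additive) Haar measure on a locally compact
  Hausdorff group is ample (the measures of the remark: `ℚ_p`, `ℝ`, `ℂ`, their unit groups, [AbsTopIII] Prop. 5.7);
* `Rss.isAmple_Icc`, `Rss.isAmpleSpace_volume_real` — `[0,1] ⊆ ℝ` is ample for Lebesgue measure; `(ℝ, Leb)` is ample.

No definitions; nothing of the IUT series is asserted; no side is taken on [IUTchIII] Cor. 3.12.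
-/

noncomputable section

namespace Literature.IUT.LogThetaLattice

open _root_.MeasureTheory _root_.Set _root_.Topology
open scoped NNReal ENNReal

namespace Rss

universe u

variable {M : Type u} [TopologicalSpace M] [MeasurableSpace M]

/-- A compact set in a Hausdorff Borel space is pre-ample (relatively compact and Borel).
[cite: Mochizuki2012, III Rmk 3.9.4 (i) p.120] -/
theorem isPreAmple_of_isCompact [T2Space M] [OpensMeasurableSpace M] {K : Set M} (hK : IsCompact K) :
    IsPreAmple K where
  relCompact := by rw [hK.isClosed.closure_eq]; exact hK
  measurableSet := hK.isClosed.measurableSet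

/-- A compact set of positive measure is ample. [cite: Mochizuki2012, III Rmk 3.9.4 (i) p.120] -/
theorem isAmple_of_isCompact [T2Space M] [OpensMeasurableSpace M] (μ : Measure M) {K : Set M}
    (hK : IsCompact K) (hpos : 0 < μ K) : IsAmple μ K where
  preAmple := isPreAmple_of_isCompact hK
  pos := hpos

/-- **Every open-positive measure on a nonempty locally compact Hausdorff space is ample** ("`(M, μ_M)` is ample
if there exists an ample subset"): a compact neighbourhood of a point contains a nonempty open set, hence has positive
measure. [cite: Mochizuki2012, III Rmk 3.9.4 (i) p.120] -/
theorem isAmpleSpace_of_isOpenPosMeasure [T2Space M] [LocallyCompactSpace M] [OpensMeasurableSpace M] [Nonempty M]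
    (μ : Measure M) [μ.IsOpenPosMeasure] : IsAmpleSpace μ := by
  obtain ⟨x⟩ := (inferInstance : Nonempty M)
  obtain ⟨K, hK, hKx⟩ := exists_compact_mem_nhds x
  refine ⟨⟨K, isAmple_of_isCompact μ hK ?_⟩⟩
  have hint : 0 < μ (interior K) :=
    isOpen_interior.measure_pos μ ⟨x, mem_interior_iff_mem_nhds.mpr hKx⟩
  exact hint.trans_le (measure_mono interior_subset)

/-- Every Haar measure on a nonempty locally compact Hausdorff group is ample (e.g. on `ℚ_p^×`, `𝒪^×`).
[cite: Mochizuki2012, III Rmk 3.9.4 (i) p.120] -/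
theorem isAmpleSpace_of_isHaarMeasure [T2Space M] [LocallyCompactSpace M] [BorelSpace M] [Group M]
    [IsTopologicalGroup M] (μ : Measure M) [μ.IsHaarMeasure] : IsAmpleSpace μ :=
  isAmpleSpace_of_isOpenPosMeasure μ

/-- Every additive Haar measure on a nonempty locally compact Hausdorff additive group is ample (e.g. on `ℚ_p`, `ℝ`,
`ℂ`, the log-shells' ambient spaces of the remark). [cite: Mochizuki2012, III Rmk 3.9.4 (i) p.120] -/
theorem isAmpleSpace_of_isAddHaarMeasure [T2Space M] [LocallyCompactSpace M] [BorelSpace M] [AddGroup M]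
    [IsTopologicalAddGroup M] (μ : Measure M) [μ.IsAddHaarMeasure] : IsAmpleSpace μ :=
  isAmpleSpace_of_isOpenPosMeasure μ

/-- `[0,1] ⊆ ℝ` is an ample subset for Lebesgue measure (`μ [0,1] = 1 > 0`). [cite: Mochizuki2012, III Rmk 3.9.4 (i) p.120] -/
theorem isAmple_Icc : IsAmple (volume : Measure ℝ) (Icc (0 : ℝ) 1) :=
  isAmple_of_isCompact volume isCompact_Icc (by rw [Real.volume_Icc]; norm_num)

/-- `(ℝ, Lebesgue)` is an ample measure space. [cite: Mochizuki2012, III Rmk 3.9.4 (i) p.120] -/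
theorem isAmpleSpace_volume_real : IsAmpleSpace (volume : Measure ℝ) := ⟨⟨_, isAmple_Icc⟩⟩

/-- Hence the PROVED surjectivity `∫^{Rss}_ℝ : Rss(ℝ) ↠ ℝ_{≥0}` of Rmk 3.9.4 (i) applies to Lebesgue measure outright
(its two hypotheses are discharged: `(ℝ, Leb)` is ample and every ample subset, being relatively compact, has finite
measure). [cite: Mochizuki2012, III Rmk 3.9.4 (i) p.121] -/
theorem integral_surjective_volume_real (t : ℝ≥0) :
    ∃ x : Carrier (volume : Measure ℝ), integral (volume : Measure ℝ) x = t :=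
  Rss_integral_surjective_holds volume isAmpleSpace_volume_real
    (fun _ hS => ((measure_mono subset_closure).trans_lt hS.preAmple.relCompact.measure_lt_top).ne) t

end Rss

end Literature.IUT.LogThetaLattice

end
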